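import Mathlib
import HarnessLib
import Summits.RiemannHypothesis.RiemannHypothesis.Theses.RuelleBand
import Literature.Analysis.UnboundedOperators.DiagonalOperatorCompact

/-!
# RiemannHypothesis / RuelleBand — `AsymptoticToRealisation` (the diagonal calibration)

Route `RiemannHypothesis/RuelleBand`, support item `stmt-RiemannHypothesis-2067`:

  `AsymptoticToRealisation : AsymptoticCriticalLine → BandRealisation`.

**Proof (the "diagonal cheat").** Index a Hilbert space by the non-trivial zeros themselves:
`ι := {s // ζ s = 0 ∧ 0 < Re s < 1}`, `H := ℓ²(ι, ℂ)` with its standard Hilbert basis `b`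
(`default : HilbertBasis ι ℂ ℓ²(ι, ℂ)`). For `t : ℝ` let `T t := diag (e^{t(ρ − 1/2)})_ρ`
(`HilbertBasis.diagonalCLM`, symbol bounded by `e^{|t|}` since `0 < Re ρ < 1`). Then `T 0 = 1`,
`T (s + t) = T s ∘ T t` (coordinates), every basis vector `b ρ` is a joint eigenvector with
character `e^{t(ρ − 1/2)}` (`diagonalCLM_basis`), `U := diag (e^{i Im ρ})` is unitary
(`diag(m)† = diag(m̄)`, `|e^{iy}| = 1`), and
`T 1 − U = diag (e^{i Im ρ}(e^{Re ρ − 1/2} − 1))` has symbol of modulus `|e^{Re ρ − 1/2} − 1| → 0`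
along the cofinite filter — because `AsymptoticCriticalLine` says that for every `ε > 0` only
finitely many zeros have `|Re ρ − 1/2| ≥ ε` — hence is compact
(`HilbertBasis.isCompactOperator_diagonalCLM_of_tendsto_zero`, Halmos Problem 171).

No enumeration of the zeros and no infinitude/countability input is needed: the index type is
the zero set itself. The operator-theoretic part is proved for an arbitrary family
`ρ : ι → ℂ` with `0 < Re (ρ i) < 1` and `Re (ρ i) → 1/2` cofinitely (`exists_diagonalBandGroup`).

References: P. R. Halmos, *A Hilbert Space Problem Book* (1982), Problems 61–63, 171;
in tree `Literature/Analysis/UnboundedOperators/DiagonalOperator{,Compact}.lean`.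
-/

noncomputable section

namespace Summit.RiemannHypothesis.RiemannHypothesis.Theorems

open Complex Filter Topology
open scoped lp
open Summit.RiemannHypothesis.RiemannHypothesis.Theses.RuelleBand

section Diagonal

variable {ι H : Type*} [NormedAddCommGroup H] [InnerProductSpace ℂ H]

/-- `diag` is additive in its symbol: `diag(m − n) = diag(m) − diag(n)` (coordinates). [folklore] -/
theorem hilbertBasis_diagonalCLM_sub (b : HilbertBasis ι ℂ H) (m n : lp (fun _ : ι => ℂ) ⊤) :
    b.diagonalCLM (m - n) = b.diagonalCLM m - b.diagonalCLM n := by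
  ext x
  apply b.repr.injective
  ext i
  simp only [HilbertBasis.diagonalCLM_apply_repr, lp.coeFn_sub, Pi.sub_apply,
    sub_apply, map_sub, sub_mul]

/-- A diagonal operator with unimodular symbol is unitary: `diag(u)† diag(u) = diag(ū u) = 1`.
[folklore] -/
theorem hilbertBasis_diagonalCLM_mem_unitary [CompleteSpace H] (b : HilbertBasis ι ℂ H)
    (u : lp (fun _ : ι => ℂ) ⊤) (hu : ∀ i, ‖u i‖ = 1) :
    b.diagonalCLM u ∈ unitary (H →L[ℂ] H) := by
  have h1 : star u * u = 1 := by
    ext i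
    rw [lp.infty_coeFn_mul, Pi.mul_apply, lp.star_apply, lp.infty_coeFn_one, Pi.one_apply,
      RCLike.star_def, RCLike.conj_mul, hu i]
    simp
  have h2 : u * star u = 1 := by rw [mul_comm]; exact h1
  rw [Unitary.mem_iff, ContinuousLinearMap.star_eq_adjoint, b.adjoint_diagonalCLM,
    ← b.diagonalCLM_mul, ← b.diagonalCLM_mul, h1, h2, b.diagonalCLM_one]
  exact ⟨rfl, rfl⟩

/-- The diagonal group at time `0` is the identity: `diag(e^{0·(ρ − 1/2)}) = 1`. [folklore] -/
theorem hilbertBasis_diagonalCLM_symbol_zero (b : HilbertBasis ι ℂ H) (ρ : ι → ℂ)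
    (m : ℝ → lp (fun _ : ι => ℂ) ⊤) (hm : ∀ t i, m t i = cexp (↑t * (ρ i - 1 / 2))) :
    b.diagonalCLM (m 0) = ContinuousLinearMap.id ℂ H := by
  ext x
  apply b.repr.injective
  ext i
  simp [hm]

/-- The diagonal group law: `diag(e^{(s+t)(ρ − 1/2)}) = diag(e^{s(ρ − 1/2)}) ∘ diag(e^{t(ρ − 1/2)})`.
[folklore] -/
theorem hilbertBasis_diagonalCLM_symbol_add (b : HilbertBasis ι ℂ H) (ρ : ι → ℂ)
    (m : ℝ → lp (fun _ : ι => ℂ) ⊤) (hm : ∀ t i, m t i = cexp (↑t * (ρ i - 1 / 2))) (s t : ℝ) :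
    b.diagonalCLM (m (s + t)) = (b.diagonalCLM (m s)).comp (b.diagonalCLM (m t)) := by
  ext x
  apply b.repr.injective
  ext i
  simp only [HilbertBasis.diagonalCLM_apply_repr, ContinuousLinearMap.coe_comp,
    Function.comp_apply, hm]
  push_cast
  rw [add_mul, Complex.exp_add, mul_assoc]

/-- The modulus of the symbol of `T 1 − U`: `|e^{ρ − 1/2} − e^{i Im ρ}| = |e^{Re ρ − 1/2} − 1|`.
[folklore] -/
theorem norm_cexp_sub_half_sub_cexp_im (z : ℂ) :
    ‖cexp (z - 1 / 2) - cexp (z.im * I)‖ = |Real.exp (z.re - 1 / 2) - 1| := by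
  have hz : z - 1 / 2 = ((z.re - 1 / 2 : ℝ) : ℂ) + z.im * I := by
    apply Complex.ext <;> simp
  rw [hz, Complex.exp_add, ← sub_one_mul, norm_mul, Complex.norm_exp_ofReal_mul_I, mul_one,
    ← Complex.ofReal_exp, ← Complex.ofReal_one, ← Complex.ofReal_sub, Complex.norm_real,
    Real.norm_eq_abs]

/-- Compactness of `T 1 − U = diag(e^{ρ − 1/2} − e^{i Im ρ})` when `Re ρ → 1/2` cofinitely: the
symbol has modulus `|e^{Re ρ − 1/2} − 1| → 0`, so Halmos's criterion
(`HilbertBasis.isCompactOperator_diagonalCLM_of_tendsto_zero`) applies. [folklore] -/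
theorem hilbertBasis_isCompactOperator_diagonalCLM_sub [CompleteSpace H] (b : HilbertBasis ι ℂ H)
    (ρ : ι → ℂ) (hlim : ∀ ε : ℝ, 0 < ε → {i : ι | ε ≤ |(ρ i).re - 1 / 2|}.Finite)
    (m₁ u : lp (fun _ : ι => ℂ) ⊤) (hm₁ : ∀ i, m₁ i = cexp (ρ i - 1 / 2))
    (hu : ∀ i, u i = cexp ((ρ i).im * I)) :
    IsCompactOperator (b.diagonalCLM m₁ - b.diagonalCLM u) := by
  rw [← hilbertBasis_diagonalCLM_sub]
  apply b.isCompactOperator_diagonalCLM_of_tendsto_zero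
  have key : (fun i => ‖(m₁ - u) i‖) = fun i => |Real.exp ((ρ i).re - 1 / 2) - 1| := by
    funext i
    rw [lp.coeFn_sub, Pi.sub_apply, hm₁, hu, norm_cexp_sub_half_sub_cexp_im]
  rw [key]
  have h0 : Tendsto (fun i => (ρ i).re - 1 / 2) cofinite (𝓝 0) := by
    rw [Metric.tendsto_nhds]
    intro ε hε
    simp only [dist_zero_right, Real.norm_eq_abs, eventually_cofinite, not_lt]
    exact hlim ε hε
  have hg : Continuous fun x : ℝ => |Real.exp x - 1| := (Real.continuous_exp.sub continuous_const).abs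
  have h := (hg.tendsto 0).comp h0
  simpa [Function.comp_def] using h

end Diagonal

/-- **The diagonal band group.** For any family `ρ : ι → ℂ` in the open critical strip whose real
parts tend to `1/2` along the cofinite filter, the diagonal operators `T t := diag(e^{t(ρ i − 1/2)})`
on `ℓ²(ι, ℂ)` form a one-parameter group with `T 1 − diag(e^{i Im ρ i})` compact,
`diag(e^{i Im ρ i})` unitary, and every `ρ i` a joint eigenvalue (eigenvector the `i`-th basis
vector). [folklore] -/
theorem exists_diagonalBandGroup {ι : Type} (ρ : ι → ℂ) (hρ : ∀ i, 0 < (ρ i).re ∧ (ρ i).re < 1)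
    (hlim : ∀ ε : ℝ, 0 < ε → {i : ι | ε ≤ |(ρ i).re - 1 / 2|}.Finite) :
    ∃ T : ℝ → ℓ²(ι, ℂ) →L[ℂ] ℓ²(ι, ℂ), T 0 = ContinuousLinearMap.id ℂ _ ∧
      (∀ s t : ℝ, T (s + t) = (T s).comp (T t)) ∧
      (∃ t₀ : ℝ, 0 < t₀ ∧ ∃ U : ℓ²(ι, ℂ) →L[ℂ] ℓ²(ι, ℂ),
        U ∈ unitary (ℓ²(ι, ℂ) →L[ℂ] ℓ²(ι, ℂ)) ∧ IsCompactOperator (T t₀ - U)) ∧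
      ∀ i : ι, ∃ v : ℓ²(ι, ℂ), v ≠ 0 ∧ ∀ t : ℝ, T t v = cexp (↑t * (ρ i - 1 / 2)) • v := by
  set b : HilbertBasis ι ℂ ℓ²(ι, ℂ) := default
  -- the symbols `e^{t(ρ − 1/2)}` are bounded by `e^{|t|}`
  have hmem : ∀ t : ℝ, Memℓp (fun i => cexp (↑t * (ρ i - 1 / 2))) ⊤ := by
    intro t
    refine memℓp_infty ⟨Real.exp |t|, ?_⟩
    rintro _ ⟨i, rfl⟩
    dsimp only
    rw [Complex.norm_exp, Real.exp_le_exp, Complex.re_ofReal_mul]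
    have h1 : |(ρ i - 1 / 2).re| ≤ 1 := by
      have := hρ i
      rw [abs_le]
      constructor <;> simp <;> linarith
    calc t * (ρ i - 1 / 2).re ≤ |t * (ρ i - 1 / 2).re| := le_abs_self _
      _ = |t| * |(ρ i - 1 / 2).re| := abs_mul _ _
      _ ≤ |t| * 1 := mul_le_mul_of_nonneg_left h1 (abs_nonneg _)
      _ = |t| := mul_one _
  set m : ℝ → lp (fun _ : ι => ℂ) ⊤ := fun t => ⟨_, hmem t⟩
  have hm : ∀ t i, m t i = cexp (↑t * (ρ i - 1 / 2)) := fun t i => rfl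
  -- the unitary symbol `e^{i Im ρ}`
  have humem : Memℓp (fun i => cexp ((ρ i).im * I)) ⊤ := by
    refine memℓp_infty ⟨1, ?_⟩
    rintro _ ⟨i, rfl⟩
    exact (Complex.norm_exp_ofReal_mul_I _).le
  set u : lp (fun _ : ι => ℂ) ⊤ := ⟨_, humem⟩
  have hu : ∀ i, u i = cexp ((ρ i).im * I) := fun i => rfl
  refine ⟨fun t => b.diagonalCLM (m t), hilbertBasis_diagonalCLM_symbol_zero b ρ m hm,
    hilbertBasis_diagonalCLM_symbol_add b ρ m hm, ⟨1, one_pos, b.diagonalCLM u, ?_, ?_⟩, ?_⟩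
  · exact hilbertBasis_diagonalCLM_mem_unitary b u fun i => by
      rw [hu, Complex.norm_exp_ofReal_mul_I]
  · refine hilbertBasis_isCompactOperator_diagonalCLM_sub b ρ hlim (m 1) u (fun i => ?_) hu
    rw [hm]
    push_cast
    rw [one_mul]
  · intro i
    refine ⟨b i, b.orthonormal.ne_zero i, fun t => ?_⟩
    rw [b.diagonalCLM_basis, hm]

/-- **`AsymptoticToRealisation` (stmt-RiemannHypothesis-2067), proved.** Assuming
`AsymptoticCriticalLine`, the diagonal band group on `ℓ²` over the set of non-trivial zeros
(`exists_diagonalBandGroup` with `ρ = Subtype.val`) witnesses `BandRealisation`: the typed crux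
`BandRealisation` carries exactly the zero-side content of rung #4. [folklore] -/
theorem asymptoticToRealisation_proof : AsymptoticToRealisation := by
  intro hA
  have hlim : ∀ ε : ℝ, 0 < ε →
      {i : {s : ℂ // riemannZeta s = 0 ∧ 0 < s.re ∧ s.re < 1} | ε ≤ |(i : ℂ).re - 1 / 2|}.Finite := by
    intro ε hε
    refine ((hA ε hε).preimage Set.injOn_subtype_val).subset ?_
    intro i hi
    exact ⟨i.2.1, i.2.2.1, i.2.2.2, hi⟩
  obtain ⟨T, h0, hadd, hcpt, heig⟩ :=
    exists_diagonalBandGroup (ι := {s : ℂ // riemannZeta s = 0 ∧ 0 < s.re ∧ s.re < 1})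
      (fun i => (i : ℂ)) (fun i => i.2.2) hlim
  exact ⟨ℓ²({s : ℂ // riemannZeta s = 0 ∧ 0 < s.re ∧ s.re < 1}, ℂ), inferInstance, inferInstance,
    inferInstance, T, h0, hadd, hcpt, fun s hs hpos hlt => heig ⟨s, hs, hpos, hlt⟩⟩

end Summit.RiemannHypothesis.RiemannHypothesis.Theorems

end
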